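import Mathlib
import HarnessLib
import Summits.NavierStokesRegularity.NavierStokesRegularity.Theorems.LrcModEntire.Negative.TwistedColumnODE

/-!
# Item `LrcModEntire` (stmt-NavierStokesRegularity-20428) — negative side: the TWISTED (TH) COLUMN, II: the field and its
# vorticity pattern

Negative-side support (refuter seat ns-regularity-refuter1; D-0081 §C), continuing `…Negative.TwistedColumnODE` (all
definitions are there): the bounds `|P|, |Q| ≤ 1`, `|P₁|, |Q₁| ≤ 4` and real-analyticity of the one-variable data, then
* `twistField`: `V(x) = (−P₁(x₂) sin x₀, −Q₁(x₂) sin x₁, P(x₂) cos x₀ + Q(x₂) cos x₁)`, its derivative `twistDeriv` as an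
  explicit continuous linear map (`hasFDerivAt_twistField`), components, `‖V‖ ≤ 10`;
* `twistVort`: the vorticity pattern `K = curl V = (m(x₂) − 1)(Q(x₂) sin x₁, −P(x₂) sin x₀, 0)` and its derivative
  `twistVortDeriv` (`hasFDerivAt_twistVort`), components;
* the special values at the heights `0` and `1/10` (`W(0) = 3`, `P(0) = 1/3`, `Q(0) = 0`, `Q₁(0) = 3`, `m'(0) = 0`) and the
  phase window `θ(h) ∈ (0, π/2)`, `P(h), Q(h) > 0` for `0 < h < 3/20` (used by `…Window` and `…Germs`).
The profile `v(t, x) = (−t)^{-1/2} V(x)` and its class data are in `…Negative.TwistedColumn`.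
WHAT THIS IS NOT: not a claim about Navier–Stokes regularity — explicit vector calculus for a kinematic witness. [folklore]
-/

noncomputable section

-- the summit and its single sub-problem share the name (CONVENTIONS §1), as in every Theorems file
set_option linter.dupNamespace false

namespace Summit.NavierStokesRegularity.NavierStokesRegularity.Theorems.LrcModEntire.Negative

open Set Function Filter Topology

local notation "E3" => EuclideanSpace ℝ (Fin 3)
local notation "π" i => (EuclideanSpace.proj (𝕜 := ℝ) (i : Fin 3) : EuclideanSpace ℝ (Fin 3) →L[ℝ] ℝ)
local notation "𝐞" i => (EuclideanSpace.single (i : Fin 3) (1 : ℝ) : EuclideanSpace ℝ (Fin 3))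

/-! ## Bounds and real-analyticity of the one-variable data -/

/-- `|P| ≤ 1`. [folklore] -/
theorem abs_twistP_le (h : ℝ) : |twistP h| ≤ 1 := by
  unfold twistP
  rw [abs_div, abs_of_pos (twistW_pos h)]
  exact div_le_one_of_le₀ ((Real.abs_cos_le_one _).trans (one_le_twistW h)) (twistW_pos h).le

/-- `|Q| ≤ 1`. [folklore] -/
theorem abs_twistQ_le (h : ℝ) : |twistQ h| ≤ 1 := by
  unfold twistQ
  rw [abs_div, abs_of_pos (twistW_pos h)]
  exact div_le_one_of_le₀ ((Real.abs_sin_le_one _).trans (one_le_twistW h)) (twistW_pos h).le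

/-- `|P₁| ≤ 4`. [folklore] -/
theorem abs_twistP₁_le (h : ℝ) : |twistP₁ h| ≤ 4 := by
  have hW1 := one_le_twistW h
  have hW3 := twistW_le_three h
  have hWpos := twistW_pos h
  have hS := Real.abs_sin_le_one (twistTheta h)
  have hC := Real.abs_cos_le_one (twistTheta h)
  have hs := Real.abs_sin_le_one h
  unfold twistP₁
  refine (abs_add_le _ _).trans ?_
  rw [abs_neg, abs_mul, abs_div, abs_mul, abs_of_pos hWpos, abs_of_pos (pow_pos hWpos 2)]
  have h1 : twistW h * |Real.sin (twistTheta h)| ≤ 3 := by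
    nlinarith [abs_nonneg (Real.sin (twistTheta h))]
  have h2 : |Real.cos (twistTheta h)| * |Real.sin h| / twistW h ^ 2 ≤ 1 := by
    rw [div_le_one (pow_pos hWpos 2)]
    nlinarith [abs_nonneg (Real.cos (twistTheta h)), abs_nonneg (Real.sin h)]
  linarith

/-- `|Q₁| ≤ 4`. [folklore] -/
theorem abs_twistQ₁_le (h : ℝ) : |twistQ₁ h| ≤ 4 := by
  have hW1 := one_le_twistW h
  have hW3 := twistW_le_three h
  have hWpos := twistW_pos h
  have hS := Real.abs_sin_le_one (twistTheta h)
  have hC := Real.abs_cos_le_one (twistTheta h)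
  have hs := Real.abs_sin_le_one h
  unfold twistQ₁
  refine (abs_add_le _ _).trans ?_
  rw [abs_mul, abs_div, abs_mul, abs_of_pos hWpos, abs_of_pos (pow_pos hWpos 2)]
  have h1 : twistW h * |Real.cos (twistTheta h)| ≤ 3 := by
    nlinarith [abs_nonneg (Real.cos (twistTheta h))]
  have h2 : |Real.sin (twistTheta h)| * |Real.sin h| / twistW h ^ 2 ≤ 1 := by
    rw [div_le_one (pow_pos hWpos 2)]
    nlinarith [abs_nonneg (Real.sin (twistTheta h)), abs_nonneg (Real.sin h)]
  linarith

/-- `W`, `θ`, `P`, `Q`, `P₁`, `Q₁`, `m` are real-analytic. [folklore] -/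
theorem analyticAt_twistW (h : ℝ) : AnalyticAt ℝ twistW h := by
  have H : AnalyticAt ℝ (fun h => 2 + Real.cos h) h := analyticAt_const.add Real.analyticAt_cos
  exact H

/-- `θ` is real-analytic. [folklore] -/
theorem analyticAt_twistTheta (h : ℝ) : AnalyticAt ℝ twistTheta h := by
  have H : AnalyticAt ℝ (fun h => 9 / 2 * h + 4 * Real.sin h + 1 / 2 * (Real.sin h * Real.cos h)) h :=
    ((analyticAt_const.mul analyticAt_id).add (analyticAt_const.mul Real.analyticAt_sin)).add
      (analyticAt_const.mul (Real.analyticAt_sin.mul Real.analyticAt_cos))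
  exact H

/-- `P` is real-analytic. [folklore] -/
theorem analyticAt_twistP (h : ℝ) : AnalyticAt ℝ twistP h := by
  have H : AnalyticAt ℝ (fun h => Real.cos (twistTheta h) / twistW h) h :=
    ((Real.analyticAt_cos (x := twistTheta h)).comp (analyticAt_twistTheta h)).div (analyticAt_twistW h)
      (twistW_ne_zero h)
  exact H

/-- `Q` is real-analytic. [folklore] -/
theorem analyticAt_twistQ (h : ℝ) : AnalyticAt ℝ twistQ h := by
  have H : AnalyticAt ℝ (fun h => Real.sin (twistTheta h) / twistW h) h :=
    ((Real.analyticAt_sin (x := twistTheta h)).comp (analyticAt_twistTheta h)).div (analyticAt_twistW h)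
      (twistW_ne_zero h)
  exact H

/-- `P₁` is real-analytic. [folklore] -/
theorem analyticAt_twistP₁ (h : ℝ) : AnalyticAt ℝ twistP₁ h := by
  have hs : AnalyticAt ℝ (fun h => Real.sin (twistTheta h)) h :=
    (Real.analyticAt_sin (x := twistTheta h)).comp (analyticAt_twistTheta h)
  have hc : AnalyticAt ℝ (fun h => Real.cos (twistTheta h)) h :=
    (Real.analyticAt_cos (x := twistTheta h)).comp (analyticAt_twistTheta h)
  have H : AnalyticAt ℝ
      (fun h => -(twistW h * Real.sin (twistTheta h)) + Real.cos (twistTheta h) * Real.sin h / twistW h ^ 2) h :=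
    ((analyticAt_twistW h).mul hs).neg.add
      ((hc.mul Real.analyticAt_sin).div ((analyticAt_twistW h).pow 2) (pow_ne_zero 2 (twistW_ne_zero h)))
  exact H

/-- `Q₁` is real-analytic. [folklore] -/
theorem analyticAt_twistQ₁ (h : ℝ) : AnalyticAt ℝ twistQ₁ h := by
  have hs : AnalyticAt ℝ (fun h => Real.sin (twistTheta h)) h :=
    (Real.analyticAt_sin (x := twistTheta h)).comp (analyticAt_twistTheta h)
  have hc : AnalyticAt ℝ (fun h => Real.cos (twistTheta h)) h :=
    (Real.analyticAt_cos (x := twistTheta h)).comp (analyticAt_twistTheta h)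
  have H : AnalyticAt ℝ
      (fun h => twistW h * Real.cos (twistTheta h) + Real.sin (twistTheta h) * Real.sin h / twistW h ^ 2) h :=
    ((analyticAt_twistW h).mul hc).add
      ((hs.mul Real.analyticAt_sin).div ((analyticAt_twistW h).pow 2) (pow_ne_zero 2 (twistW_ne_zero h)))
  exact H

/-- `m` is real-analytic. [folklore] -/
theorem analyticAt_twistSlope (h : ℝ) : AnalyticAt ℝ twistSlope h := by
  have H : AnalyticAt ℝ
      (fun h => (twistW h * Real.cos h + 2 * Real.sin h ^ 2) / twistW h ^ 2 - twistW h ^ 4) h :=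
    ((((analyticAt_twistW h).mul Real.analyticAt_cos).add (analyticAt_const.mul (Real.analyticAt_sin.pow 2))).div
        ((analyticAt_twistW h).pow 2) (pow_ne_zero 2 (twistW_ne_zero h))).sub ((analyticAt_twistW h).pow 4)
  exact H

/-! ## The twisted column field and its vorticity pattern: calculus -/

/-- `V` is differentiable with derivative `twistDeriv`. [folklore] -/
theorem hasFDerivAt_twistField (x : E3) : HasFDerivAt twistField (twistDeriv x) x := by
  have h0 : HasFDerivAt (fun y : E3 => y 0) (π 0) x := (π 0).hasFDerivAt
  have h1 : HasFDerivAt (fun y : E3 => y 1) (π 1) x := (π 1).hasFDerivAt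
  have h2 : HasFDerivAt (fun y : E3 => y 2) (π 2) x := (π 2).hasFDerivAt
  have hc0 := (Real.hasDerivAt_cos (x 0)).comp_hasFDerivAt x h0
  have hc1 := (Real.hasDerivAt_cos (x 1)).comp_hasFDerivAt x h1
  have hs0 := (Real.hasDerivAt_sin (x 0)).comp_hasFDerivAt x h0
  have hs1 := (Real.hasDerivAt_sin (x 1)).comp_hasFDerivAt x h1
  have hP := (hasDerivAt_twistP (x 2)).comp_hasFDerivAt x h2
  have hQ := (hasDerivAt_twistQ (x 2)).comp_hasFDerivAt x h2
  have hP1 := (hasDerivAt_twistP₁ (x 2)).comp_hasFDerivAt x h2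
  have hQ1 := (hasDerivAt_twistQ₁ (x 2)).comp_hasFDerivAt x h2
  have H := ((((hP1.mul hs0).neg).smul_const (𝐞 0)).add (((hQ1.mul hs1).neg).smul_const (𝐞 1))).add
    (((hP.mul hc0).add (hQ.mul hc1)).smul_const (𝐞 2))
  exact H

/-- `DV = twistDeriv`. [folklore] -/
theorem fderiv_twistField (x : E3) : fderiv ℝ twistField x = twistDeriv x :=
  (hasFDerivAt_twistField x).fderiv

/-- `V` is continuous. [folklore] -/
theorem continuous_twistField : Continuous twistField := by
  have hd : Differentiable ℝ twistField := fun x => (hasFDerivAt_twistField x).differentiableAt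
  exact hd.continuous

/-- `DV(x) w` in coordinates. [folklore] -/
theorem twistDeriv_apply (x w : E3) : twistDeriv x w =
    (-(twistP₁ (x 2) * (Real.cos (x 0) * w 0) + Real.sin (x 0) * ((twistSlope (x 2) * twistP (x 2)) * w 2))) • (𝐞 0) +
    (-(twistQ₁ (x 2) * (Real.cos (x 1) * w 1) + Real.sin (x 1) * ((twistSlope (x 2) * twistQ (x 2)) * w 2))) • (𝐞 1) +
    ((twistP (x 2) * (-(Real.sin (x 0)) * w 0) + Real.cos (x 0) * (twistP₁ (x 2) * w 2)) +
      (twistQ (x 2) * (-(Real.sin (x 1)) * w 1) + Real.cos (x 1) * (twistQ₁ (x 2) * w 2))) • (𝐞 2) := by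
  rfl

/-- The components of `V(x)`. [folklore] -/
theorem twistField_apply_zero (x : E3) : twistField x 0 = -(twistP₁ (x 2) * Real.sin (x 0)) := by
  simp [twistField]

/-- The second component of `V(x)`. [folklore] -/
theorem twistField_apply_one (x : E3) : twistField x 1 = -(twistQ₁ (x 2) * Real.sin (x 1)) := by
  simp [twistField]

/-- The third component of `V(x)`. [folklore] -/
theorem twistField_apply_two (x : E3) :
    twistField x 2 = twistP (x 2) * Real.cos (x 0) + twistQ (x 2) * Real.cos (x 1) := by
  simp [twistField]

/-- The components of `DV(x) w`. [folklore] -/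
theorem twistDeriv_apply_zero (x w : E3) : twistDeriv x w 0 =
    -(twistP₁ (x 2) * (Real.cos (x 0) * w 0) + Real.sin (x 0) * ((twistSlope (x 2) * twistP (x 2)) * w 2)) := by
  rw [twistDeriv_apply]; simp

/-- The second component of `DV(x) w`. [folklore] -/
theorem twistDeriv_apply_one (x w : E3) : twistDeriv x w 1 =
    -(twistQ₁ (x 2) * (Real.cos (x 1) * w 1) + Real.sin (x 1) * ((twistSlope (x 2) * twistQ (x 2)) * w 2)) := by
  rw [twistDeriv_apply]; simp

/-- The third component of `DV(x) w`. [folklore] -/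
theorem twistDeriv_apply_two (x w : E3) : twistDeriv x w 2 =
    (twistP (x 2) * (-(Real.sin (x 0)) * w 0) + Real.cos (x 0) * (twistP₁ (x 2) * w 2)) +
      (twistQ (x 2) * (-(Real.sin (x 1)) * w 1) + Real.cos (x 1) * (twistQ₁ (x 2) * w 2)) := by
  rw [twistDeriv_apply]; simp

/-- `‖V(x)‖ ≤ 10` (`|P₁|, |Q₁| ≤ 4`, `|P|, |Q| ≤ 1`). [folklore] -/
theorem norm_twistField_le (x : E3) : ‖twistField x‖ ≤ 10 := by
  have hP1 := abs_twistP₁_le (x 2)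
  have hQ1 := abs_twistQ₁_le (x 2)
  have hP := abs_twistP_le (x 2)
  have hQ := abs_twistQ_le (x 2)
  have hs0 := Real.abs_sin_le_one (x 0)
  have hs1 := Real.abs_sin_le_one (x 1)
  have hc0 := Real.abs_cos_le_one (x 0)
  have hc1 := Real.abs_cos_le_one (x 1)
  have e0 : ‖(𝐞 0)‖ = 1 := by simp
  have e1 : ‖(𝐞 1)‖ = 1 := by simp
  have e2 : ‖(𝐞 2)‖ = 1 := by simp
  unfold twistField
  refine (norm_add_le _ _).trans ?_
  refine (add_le_add (norm_add_le _ _) le_rfl).trans ?_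
  rw [norm_smul, norm_smul, norm_smul, e0, e1, e2, mul_one, mul_one, mul_one, Real.norm_eq_abs,
    Real.norm_eq_abs, Real.norm_eq_abs, abs_neg, abs_neg, abs_mul, abs_mul]
  have h1 : |twistP₁ (x 2)| * |Real.sin (x 0)| ≤ 4 := by
    nlinarith [abs_nonneg (twistP₁ (x 2)), abs_nonneg (Real.sin (x 0))]
  have h2 : |twistQ₁ (x 2)| * |Real.sin (x 1)| ≤ 4 := by
    nlinarith [abs_nonneg (twistQ₁ (x 2)), abs_nonneg (Real.sin (x 1))]
  have h3 : |twistP (x 2) * Real.cos (x 0) + twistQ (x 2) * Real.cos (x 1)| ≤ 2 := by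
    refine (abs_add_le _ _).trans ?_
    rw [abs_mul, abs_mul]
    nlinarith [abs_nonneg (twistP (x 2)), abs_nonneg (Real.cos (x 0)), abs_nonneg (twistQ (x 2)),
      abs_nonneg (Real.cos (x 1))]
  linarith

/-- `((m − 1) Q)' = (m − 1) Q₁ + m' Q`. [folklore] -/
theorem hasDerivAt_twistSlope_sub_one_mul_Q (h : ℝ) :
    HasDerivAt (fun h => (twistSlope h - 1) * twistQ h)
      ((twistSlope h - 1) * twistQ₁ h + twistSlopeD h * twistQ h) h := by
  have H := ((hasDerivAt_twistSlope h).sub_const 1).mul (hasDerivAt_twistQ h)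
  refine H.congr_deriv ?_
  ring

/-- `((m − 1) P)' = (m − 1) P₁ + m' P`. [folklore] -/
theorem hasDerivAt_twistSlope_sub_one_mul_P (h : ℝ) :
    HasDerivAt (fun h => (twistSlope h - 1) * twistP h)
      ((twistSlope h - 1) * twistP₁ h + twistSlopeD h * twistP h) h := by
  have H := ((hasDerivAt_twistSlope h).sub_const 1).mul (hasDerivAt_twistP h)
  refine H.congr_deriv ?_
  ring

/-- `K` is differentiable with derivative `twistVortDeriv`. [folklore] -/
theorem hasFDerivAt_twistVort (x : E3) : HasFDerivAt twistVort (twistVortDeriv x) x := by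
  have h0 : HasFDerivAt (fun y : E3 => y 0) (π 0) x := (π 0).hasFDerivAt
  have h1 : HasFDerivAt (fun y : E3 => y 1) (π 1) x := (π 1).hasFDerivAt
  have h2 : HasFDerivAt (fun y : E3 => y 2) (π 2) x := (π 2).hasFDerivAt
  have hs0 := (Real.hasDerivAt_sin (x 0)).comp_hasFDerivAt x h0
  have hs1 := (Real.hasDerivAt_sin (x 1)).comp_hasFDerivAt x h1
  have hA := (hasDerivAt_twistSlope_sub_one_mul_Q (x 2)).comp_hasFDerivAt x h2
  have hB := (hasDerivAt_twistSlope_sub_one_mul_P (x 2)).comp_hasFDerivAt x h2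
  have H := ((hA.mul hs1).smul_const (𝐞 0)).add (((hB.mul hs0).neg).smul_const (𝐞 1))
  have e : twistVort = fun y : E3 =>
      ((twistSlope (y 2) - 1) * twistQ (y 2) * Real.sin (y 1)) • (𝐞 0) +
        (-((twistSlope (y 2) - 1) * twistP (y 2) * Real.sin (y 0))) • (𝐞 1) := rfl
  rw [e]
  exact H

/-- `DK(x) w` in coordinates. [folklore] -/
theorem twistVortDeriv_apply (x w : E3) : twistVortDeriv x w =
    (((twistSlope (x 2) - 1) * twistQ (x 2)) * (Real.cos (x 1) * w 1) +
      Real.sin (x 1) * (((twistSlope (x 2) - 1) * twistQ₁ (x 2) + twistSlopeD (x 2) * twistQ (x 2)) * w 2)) • (𝐞 0) +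
    (-(((twistSlope (x 2) - 1) * twistP (x 2)) * (Real.cos (x 0) * w 0) +
      Real.sin (x 0) * (((twistSlope (x 2) - 1) * twistP₁ (x 2) + twistSlopeD (x 2) * twistP (x 2)) * w 2))) •
      (𝐞 1) := by
  rfl

/-- The first component of `DK(x) w`. [folklore] -/
theorem twistVortDeriv_apply_zero (x w : E3) : twistVortDeriv x w 0 =
    ((twistSlope (x 2) - 1) * twistQ (x 2)) * (Real.cos (x 1) * w 1) +
      Real.sin (x 1) * (((twistSlope (x 2) - 1) * twistQ₁ (x 2) + twistSlopeD (x 2) * twistQ (x 2)) * w 2) := by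
  rw [twistVortDeriv_apply]; simp

/-- The second component of `DK(x) w`. [folklore] -/
theorem twistVortDeriv_apply_one (x w : E3) : twistVortDeriv x w 1 =
    -(((twistSlope (x 2) - 1) * twistP (x 2)) * (Real.cos (x 0) * w 0) +
      Real.sin (x 0) * (((twistSlope (x 2) - 1) * twistP₁ (x 2) + twistSlopeD (x 2) * twistP (x 2)) * w 2)) := by
  rw [twistVortDeriv_apply]; simp

/-- The third component of `DK(x) w` vanishes. [folklore] -/
theorem twistVortDeriv_apply_two (x w : E3) : twistVortDeriv x w 2 = 0 := by
  rw [twistVortDeriv_apply]; simp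

/-! ## Special values and the admissible heights -/

/-- `θ(0) = 0`. [folklore] -/
theorem twistTheta_zero : twistTheta 0 = 0 := by simp [twistTheta]

/-- `W(0) = 3`. [folklore] -/
theorem twistW_zero : twistW 0 = 3 := by rw [twistW, Real.cos_zero]; norm_num

/-- `P(0) = 1/3`. [folklore] -/
theorem twistP_zero : twistP 0 = 1 / 3 := by rw [twistP, twistTheta_zero, twistW_zero, Real.cos_zero]

/-- `Q(0) = 0`. [folklore] -/
theorem twistQ_zero : twistQ 0 = 0 := by rw [twistQ, twistTheta_zero, Real.sin_zero, zero_div]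

/-- `Q₁(0) = 3`. [folklore] -/
theorem twistQ₁_zero : twistQ₁ 0 = 3 := by
  rw [twistQ₁, twistTheta_zero, twistW_zero, Real.cos_zero, Real.sin_zero]; norm_num

/-- `m'(0) = 0`. [folklore] -/
theorem twistSlopeD_zero : twistSlopeD 0 = 0 := by rw [twistSlopeD, Real.sin_zero, zero_mul]

/-- On the admissible heights `0 < h < 3/20` the phase lies in `(0, π/2)` (`θ ≤ 9h < 27/20 < π/2`). [folklore] -/
theorem twistTheta_mem {h : ℝ} (h0 : 0 < h) (h1 : h < 3 / 20) : 0 < twistTheta h ∧ twistTheta h < Real.pi / 2 := by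
  have hpi := Real.pi_gt_three
  have hs : 0 < Real.sin h := Real.sin_pos_of_pos_of_lt_pi h0 (by linarith)
  have hc : 0 < Real.cos h := Real.cos_pos_of_mem_Ioo ⟨by linarith, by linarith⟩
  have hsle : Real.sin h ≤ h := Real.sin_le h0.le
  have hc1 : Real.cos h ≤ 1 := Real.cos_le_one h
  have hsc : 0 < Real.sin h * Real.cos h := mul_pos hs hc
  have hsc' : Real.sin h * Real.cos h ≤ h := by nlinarith
  unfold twistTheta
  constructor
  · linarith
  · linarith

/-- `P > 0` on the admissible heights. [folklore] -/
theorem twistP_pos {h : ℝ} (h0 : 0 < h) (h1 : h < 3 / 20) : 0 < twistP h := by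
  obtain ⟨hθ0, hθ1⟩ := twistTheta_mem h0 h1
  exact div_pos (Real.cos_pos_of_mem_Ioo ⟨by linarith, hθ1⟩) (twistW_pos h)

/-- `Q > 0` on the admissible heights. [folklore] -/
theorem twistQ_pos {h : ℝ} (h0 : 0 < h) (h1 : h < 3 / 20) : 0 < twistQ h := by
  obtain ⟨hθ0, hθ1⟩ := twistTheta_mem h0 h1
  exact div_pos (Real.sin_pos_of_pos_of_lt_pi hθ0 (by linarith [Real.pi_gt_three])) (twistW_pos h)

end Summit.NavierStokesRegularity.NavierStokesRegularity.Theorems.LrcModEntire.Negative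

end
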